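import Literature.MathematicalPhysics.QuantumFieldTheory.Balaban1983to89.B11Eq135Weitzenbock
import Literature.MathematicalPhysics.QuantumFieldTheory.Balaban1983to89.B9Eq310Hermitian
import HarnessLib

/-!
# Route `UnitScaleTilt`, crux K1 «MinimiserStabilityRegPr» (stmt-QuantumFields-19200), line «route-R», stub P — CARD-19200-V3-g11 §6 (S2, curved upgrade of P-lin):
# THE EXACT CURVED LETTER EVERY S2 ROW USES — the covariant curl of a covariant gradient is the CURVATURE COMMUTATOR,
# `(D_U D_U f)(p_{μν}(x)) = R(U(∂p))·g − g`, `g = R(U_{x,ν}U_{x+e_ν,μ}) f(x+e_μ+e_ν)`, hence `‖(D_U D_U f)(p)‖ ≤ 2‖U(∂p) − 1‖·‖f(x+e_μ+e_ν)‖` at a unitary background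

Cell `ym3-torus`, width seat `ym-ust-20520-w2` (g2); sequel of this seat's LOCATED note `S2-CURVED-LOCATED-w2g2.md` (19200 evidence #44): at a flat background
`∂∂φ = 0` (`LatticeFieldCalculus.curl_grad`, used in the N7 assembly through `Prop7PinnedFlatCoercivityReal.curl_sub_grad`); at a curved one the gauge part of a Hodge
split has curl `R(U(∂p))φ − φ`, of size `2a‖φ‖` when the plaquette variables are within `a` of `1` — the defect term (a) of the note, proportional to the SIZE of the
gauge function.  THEOREMS ONLY (0 `def`, 0 `sorry`); `--supports stmt-QuantumFields-19200`, count-neutral; written in the abstract calculus of `B9Eq39Adjoint`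
(`R`, `covD`, `curl`, `plaqU`; sites `S`, shifts `T : ι → Equiv.Perm S`, background `U : ι → S → 𝔸ˣ` in a ring ∕ normed ring `𝔸`), so that it plugs into the curved
engine `Prop7CovariantCoercivity.sum_normSq_le_curl_sq_add_divB_sq(_add_avg_T3)` (`T := torusT`, `U := unitsField ∘ toUField`).  YM₃ on T³ is a ladder rung (R3),
not the Clay problem; nothing here claims S2, P, the crux or the gap.

WHAT IS PROVED (ns `…Theorems.Prop7CovariantCurlOfGrad`).
* §1 (any ring) ★ `curl_covD_eq` — `(D_U D_U f)(p_{μν}(x)) = R(U_{x,μ}U_{x+e_μ,ν}) f(x+e_ν+e_μ) − R(U_{x,ν}U_{x+e_ν,μ}) f(x+e_μ+e_ν)` (the eight first-order terms cancel);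
  ★ `curl_covD_eq_conj_plaqU` — with commuting shifts, `= R(U(∂p))·g − g`, `g := R(U_{x,ν}U_{x+e_ν,μ}) f(x+e_μ+e_ν)`, `U(∂p) = B9Eq39Adjoint.plaqU`; `curl_covD_eq_zero_of_plaqU_eq_one`
  (flat plaquette ⇒ no curvature term — the abstract `curl_grad`).
* §2 (normed ring, units of norm ≤ 1 with inverses of norm ≤ 1; the tree's `B9Eq310Hermitian.norm_R_le` and `B11Eq135Weitzenbock.norm_R_sub_self_le`
  `‖R(W)g − g‖ ≤ 2‖W − 1‖·‖g‖` by name) ★★ `norm_curl_covD_le` — `‖(D_U D_U f)(p_{μν}(x))‖ ≤ 2·‖U(∂p) − 1‖·‖f(x+e_μ+e_ν)‖`; and the bounded-operator facts `norm_covD_le` (`‖(D_Uf)(x,μ)‖ ≤ ‖f(x+e_μ)‖ + ‖f(x)‖`),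
  `norm_curl_le` (`‖(D_UA)(p)‖ ≤` the four bond norms).
HONEST SCOPE.  Exact lattice algebra ([folklore]; [Balaban1985BackgroundPropagators] (3.1)–(3.4) letters); nothing of Thm 3.11 or of S2 is proved.

References: T. Bałaban, CMP 99 (1985) 389–434 [Balaban1985BackgroundPropagators] ((3.1)–(3.4) pp.390–391); CMP 102 (1985) 277–309 [Balaban1985Variational] ((14) p.280, Prop. 7 p.299).
-/

noncomputable section

namespace Summit.QuantumFields.YangMills.Theorems.Prop7CovariantCurlOfGrad

open Literature.MathematicalPhysics.QuantumFieldTheory.Balaban1983to89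
open B9Eq39Adjoint (R R_def R_add R_sub covD curl plaqU)
open B11Eq135Weitzenbock (norm_R_sub_self_le)
open B9Eq310Hermitian (norm_R_le)

/-! ## §1 The covariant curl of a covariant gradient (any ring) -/

section RingLevel

variable {𝔸 : Type*} [Ring 𝔸] {S : Type*} {ι : Type*} (T : ι → Equiv.Perm S) (U : ι → S → 𝔸ˣ)

/-- ★ **`D_U ∘ D_U` ON SITE FUNCTIONS**: `(D_U D_U f)(p_{μν}(x)) = R(U_{x,μ}U_{x+e_μ,ν}) f(x+e_μ+e_ν)′ − R(U_{x,ν}U_{x+e_ν,μ}) f(x+e_ν+e_μ)` — the two transports of `f` around the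
two halves of the plaquette; the eight first-order terms cancel identically (no commutation of the shifts is used: the two corner sites are `T ν (T μ x)` and `T μ (T ν x)`).
[cite: Balaban1985BackgroundPropagators, (3.3)-(3.4) pp.390-391] -/
theorem curl_covD_eq (f : S → 𝔸) (μ ν : ι) (x : S) :
    curl T U (fun κ => covD T U κ f) μ ν x
      = R (U μ x * U ν (T μ x)) (f (T ν (T μ x))) - R (U ν x * U μ (T ν x)) (f (T μ (T ν x))) := by
  simp only [curl, covD, R_sub, B9Eq39Adjoint.R_mul]
  abel

/-- ★ **THE CURVATURE COMMUTATOR**: with commuting shifts (`x + e_μ + e_ν = x + e_ν + e_μ`), `(D_U D_U f)(p_{μν}(x)) = R(U(∂p)) g − g` for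
`g = R(U_{x,ν}U_{x+e_ν,μ}) f(x+e_μ+e_ν)` and `U(∂p) = U_{x,μ}U_{x+e_μ,ν}U_{x+e_ν,μ}⁻¹U_{x,ν}⁻¹` (`B9Eq39Adjoint.plaqU`). [cite: Balaban1985BackgroundPropagators, (3.1) p.390, (3.4) p.391] -/
theorem curl_covD_eq_conj_plaqU (f : S → 𝔸) (μ ν : ι) (x : S) (hT : T ν (T μ x) = T μ (T ν x)) :
    curl T U (fun κ => covD T U κ f) μ ν x
      = R (plaqU T U μ ν x) (R (U ν x * U μ (T ν x)) (f (T μ (T ν x)))) - R (U ν x * U μ (T ν x)) (f (T μ (T ν x))) := by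
  rw [curl_covD_eq, hT, ← B9Eq39Adjoint.R_mul]
  congr 2
  simp only [plaqU]
  rw [mul_assoc (U μ x * U ν (T μ x) * (U μ (T ν x))⁻¹), inv_mul_cancel_left, mul_assoc (U μ x * U ν (T μ x)), inv_mul_cancel, mul_one]

/-- A flat plaquette kills the curvature term: `U(∂p) = 1 ⇒ (D_U D_U f)(p) = 0` (the covariant form of `∂∂ = 0`). [folklore] -/
theorem curl_covD_eq_zero_of_plaqU_eq_one (f : S → 𝔸) (μ ν : ι) (x : S) (hT : T ν (T μ x) = T μ (T ν x))
    (hflat : plaqU T U μ ν x = 1) : curl T U (fun κ => covD T U κ f) μ ν x = 0 := by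
  rw [curl_covD_eq_conj_plaqU T U f μ ν x hT, hflat, B9Eq39Adjoint.R_one, sub_self]

end RingLevel

/-! ## §2 Norms at a unitary-type background (`‖u‖ ≤ 1`, `‖u⁻¹‖ ≤ 1`) -/

section NormLevel

variable {𝔸 : Type*} [NormedRing 𝔸] {S : Type*} {ι : Type*} (T : ι → Equiv.Perm S) (U : ι → S → 𝔸ˣ)

/-- ★★ **THE CURL OF A COVARIANT GRADIENT IS `O(curvature × size)`**: at a background whose bond variables and their inverses have norm at most one (unitary),
`‖(D_U D_U f)(p_{μν}(x))‖ ≤ 2·‖U(∂p) − 1‖·‖f(x+e_μ+e_ν)‖` — zero at flat plaquettes, and proportional to the SIZE of `f`, not to its covariant gradient, at curved ones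
(the defect (a) of `S2-CURVED-LOCATED-w2g2.md`). [cite: Balaban1985BackgroundPropagators, (3.1)-(3.4) pp.390-391; Balaban1985Variational, (14) p.280] -/
theorem norm_curl_covD_le (hU : ∀ (κ : ι) (y : S), ‖(U κ y : 𝔸)‖ ≤ 1 ∧ ‖(((U κ y)⁻¹ : 𝔸ˣ) : 𝔸)‖ ≤ 1)
    (f : S → 𝔸) (μ ν : ι) (x : S) (hT : T ν (T μ x) = T μ (T ν x)) :
    ‖curl T U (fun κ => covD T U κ f) μ ν x‖ ≤ 2 * ‖(plaqU T U μ ν x : 𝔸) - 1‖ * ‖f (T μ (T ν x))‖ := by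
  rw [curl_covD_eq_conj_plaqU T U f μ ν x hT]
  -- the plaquette holonomy and the half transport have inverse ∕ both of norm ≤ 1
  have hmul : ∀ {V W : 𝔸ˣ}, (‖(V : 𝔸)‖ ≤ 1 ∧ ‖((V⁻¹ : 𝔸ˣ) : 𝔸)‖ ≤ 1) → (‖(W : 𝔸)‖ ≤ 1 ∧ ‖((W⁻¹ : 𝔸ˣ) : 𝔸)‖ ≤ 1) →
      (‖((V * W : 𝔸ˣ) : 𝔸)‖ ≤ 1 ∧ ‖(((V * W)⁻¹ : 𝔸ˣ) : 𝔸)‖ ≤ 1) := by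
    intro V W hV hW
    constructor
    · rw [Units.val_mul]
      exact (norm_mul_le _ _).trans (by nlinarith [hV.1, hW.1, norm_nonneg (V : 𝔸), norm_nonneg (W : 𝔸)])
    · rw [mul_inv_rev, Units.val_mul]
      exact (norm_mul_le _ _).trans (by nlinarith [hV.2, hW.2, norm_nonneg ((W⁻¹ : 𝔸ˣ) : 𝔸), norm_nonneg ((V⁻¹ : 𝔸ˣ) : 𝔸)])
  have hinv : ∀ {V : 𝔸ˣ}, (‖(V : 𝔸)‖ ≤ 1 ∧ ‖((V⁻¹ : 𝔸ˣ) : 𝔸)‖ ≤ 1) → (‖((V⁻¹ : 𝔸ˣ) : 𝔸)‖ ≤ 1 ∧ ‖(((V⁻¹)⁻¹ : 𝔸ˣ) : 𝔸)‖ ≤ 1) := by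
    intro V hV; rw [inv_inv]; exact ⟨hV.2, hV.1⟩
  have hhalf := hmul (hU ν x) (hU μ (T ν x))
  have hplaq : ‖(plaqU T U μ ν x : 𝔸)‖ ≤ 1 ∧ ‖(((plaqU T U μ ν x)⁻¹ : 𝔸ˣ) : 𝔸)‖ ≤ 1 := by
    unfold plaqU
    exact hmul (hmul (hmul (hU μ x) (hU ν (T μ x))) (hinv (hU μ (T ν x)))) (hinv (hU ν x))
  calc ‖R (plaqU T U μ ν x) (R (U ν x * U μ (T ν x)) (f (T μ (T ν x)))) - R (U ν x * U μ (T ν x)) (f (T μ (T ν x)))‖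
      ≤ 2 * ‖(plaqU T U μ ν x : 𝔸) - 1‖ * ‖R (U ν x * U μ (T ν x)) (f (T μ (T ν x)))‖ := norm_R_sub_self_le hplaq.2 _
    _ ≤ 2 * ‖(plaqU T U μ ν x : 𝔸) - 1‖ * ‖f (T μ (T ν x))‖ :=
        mul_le_mul_of_nonneg_left (norm_R_le hhalf.1 hhalf.2 _) (by positivity)

/-- The covariant derivative is a bounded operator: `‖(D_Uf)(x,μ)‖ ≤ ‖f(x+e_μ)‖ + ‖f(x)‖`. [folklore] -/
theorem norm_covD_le (hU : ∀ (κ : ι) (y : S), ‖(U κ y : 𝔸)‖ ≤ 1 ∧ ‖(((U κ y)⁻¹ : 𝔸ˣ) : 𝔸)‖ ≤ 1) (f : S → 𝔸) (μ : ι) (x : S) :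
    ‖covD T U μ f x‖ ≤ ‖f (T μ x)‖ + ‖f x‖ := by
  unfold covD
  exact (norm_sub_le _ _).trans (add_le_add (norm_R_le (hU μ x).1 (hU μ x).2 _) le_rfl)

/-- The covariant curl is a bounded operator: `‖(D_UA)(p_{μν}(x))‖ ≤ ‖A_ν(x+e_μ)‖ + ‖A_ν(x)‖ + ‖A_μ(x+e_ν)‖ + ‖A_μ(x)‖`. [folklore] -/
theorem norm_curl_le (hU : ∀ (κ : ι) (y : S), ‖(U κ y : 𝔸)‖ ≤ 1 ∧ ‖(((U κ y)⁻¹ : 𝔸ˣ) : 𝔸)‖ ≤ 1) (A : ι → S → 𝔸) (μ ν : ι) (x : S) :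
    ‖curl T U A μ ν x‖ ≤ ‖A ν (T μ x)‖ + ‖A ν x‖ + (‖A μ (T ν x)‖ + ‖A μ x‖) := by
  unfold curl
  exact (norm_sub_le _ _).trans (add_le_add (norm_covD_le T U hU (A ν) μ x) (norm_covD_le T U hU (A μ) ν x))

/-- **THE COVARIANT CURL IS A BOUNDED OPERATOR, SUMMED** (finite site set, shifts bijective): `Σ_x Σ_μ Σ_ν ‖(D_UA)(p_{μν}(x))‖² ≤ 16·|ι|·Σ_ν Σ_x ‖A_ν(x)‖²`
(each of the four bond norms squared, the shifted sums re-indexed through the bijections `T μ`). [folklore] -/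
theorem sum_normSq_curl_le [Fintype S] [Fintype ι] (hU : ∀ (κ : ι) (y : S), ‖(U κ y : 𝔸)‖ ≤ 1 ∧ ‖(((U κ y)⁻¹ : 𝔸ˣ) : 𝔸)‖ ≤ 1)
    (A : ι → S → 𝔸) :
    ∑ x : S, ∑ μ : ι, ∑ ν : ι, ‖curl T U A μ ν x‖ ^ 2 ≤ 16 * Fintype.card ι * ∑ ν : ι, ∑ x : S, ‖A ν x‖ ^ 2 := by
  classical
  -- pointwise: `‖curl‖² ≤ 4(a² + b² + c² + d²)`
  have hpt : ∀ (x : S) (μ ν : ι), ‖curl T U A μ ν x‖ ^ 2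
      ≤ 4 * (‖A ν (T μ x)‖ ^ 2 + ‖A ν x‖ ^ 2 + ‖A μ (T ν x)‖ ^ 2 + ‖A μ x‖ ^ 2) := by
    intro x μ ν
    have h := norm_curl_le T U hU A μ ν x
    have h0 := norm_nonneg (curl T U A μ ν x)
    nlinarith [sq_nonneg (‖A ν (T μ x)‖ - ‖A ν x‖), sq_nonneg (‖A μ (T ν x)‖ - ‖A μ x‖),
      sq_nonneg (‖A ν (T μ x)‖ + ‖A ν x‖ - ‖A μ (T ν x)‖ - ‖A μ x‖),
      norm_nonneg (A ν (T μ x)), norm_nonneg (A ν x), norm_nonneg (A μ (T ν x)), norm_nonneg (A μ x)]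
  -- the four sums, each `≤ |ι|·Σ_ν Σ_x ‖A_ν(x)‖²` after re-indexing the shift
  have hshift : ∀ (μ ν : ι), ∑ x : S, ‖A ν (T μ x)‖ ^ 2 = ∑ x : S, ‖A ν x‖ ^ 2 := fun μ ν =>
    Fintype.sum_equiv (T μ) _ _ (fun _ => rfl)
  have h1 : ∑ x : S, ∑ μ : ι, ∑ ν : ι, ‖A ν (T μ x)‖ ^ 2 = Fintype.card ι * ∑ ν : ι, ∑ x : S, ‖A ν x‖ ^ 2 := by
    rw [Finset.sum_comm]
    simp_rw [Finset.sum_comm (s := (Finset.univ : Finset S)), hshift]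
    simp [Finset.sum_const, Finset.card_univ]
  have h2 : ∑ x : S, ∑ μ : ι, ∑ ν : ι, ‖A ν x‖ ^ 2 = Fintype.card ι * ∑ ν : ι, ∑ x : S, ‖A ν x‖ ^ 2 := by
    rw [Finset.sum_comm]
    simp_rw [Finset.sum_comm (s := (Finset.univ : Finset S))]
    simp [Finset.sum_const, Finset.card_univ]
  have h3 : ∑ x : S, ∑ μ : ι, ∑ ν : ι, ‖A μ (T ν x)‖ ^ 2 = Fintype.card ι * ∑ ν : ι, ∑ x : S, ‖A ν x‖ ^ 2 := by
    rw [Finset.sum_comm]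
    have : ∀ μ : ι, ∑ x : S, ∑ ν : ι, ‖A μ (T ν x)‖ ^ 2 = Fintype.card ι * ∑ x : S, ‖A μ x‖ ^ 2 := by
      intro μ
      rw [Finset.sum_comm]
      simp_rw [hshift]
      simp [Finset.sum_const, Finset.card_univ]
    simp_rw [this]
    rw [← Finset.mul_sum]
  have h4 : ∑ x : S, ∑ μ : ι, ∑ ν : ι, ‖A μ x‖ ^ 2 = Fintype.card ι * ∑ ν : ι, ∑ x : S, ‖A ν x‖ ^ 2 := by
    rw [Finset.sum_comm]
    have : ∀ μ : ι, ∑ x : S, ∑ _ν : ι, ‖A μ x‖ ^ 2 = Fintype.card ι * ∑ x : S, ‖A μ x‖ ^ 2 := by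
      intro μ
      simp [Finset.sum_const, Finset.card_univ, Finset.mul_sum]
    simp_rw [this]
    rw [← Finset.mul_sum]
  calc ∑ x : S, ∑ μ : ι, ∑ ν : ι, ‖curl T U A μ ν x‖ ^ 2
      ≤ ∑ x : S, ∑ μ : ι, ∑ ν : ι, 4 * (‖A ν (T μ x)‖ ^ 2 + ‖A ν x‖ ^ 2 + ‖A μ (T ν x)‖ ^ 2 + ‖A μ x‖ ^ 2) :=
        Finset.sum_le_sum fun x _ => Finset.sum_le_sum fun μ _ => Finset.sum_le_sum fun ν _ => hpt x μ ν
    _ = 4 * (∑ x : S, ∑ μ : ι, ∑ ν : ι, ‖A ν (T μ x)‖ ^ 2 + ∑ x : S, ∑ μ : ι, ∑ ν : ι, ‖A ν x‖ ^ 2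
          + ∑ x : S, ∑ μ : ι, ∑ ν : ι, ‖A μ (T ν x)‖ ^ 2 + ∑ x : S, ∑ μ : ι, ∑ ν : ι, ‖A μ x‖ ^ 2) := by
        simp only [Finset.mul_sum, Finset.sum_add_distrib, mul_add]
    _ = 16 * Fintype.card ι * ∑ ν : ι, ∑ x : S, ‖A ν x‖ ^ 2 := by
        rw [h1, h2, h3, h4]; ring

end NormLevel

end Summit.QuantumFields.YangMills.Theorems.Prop7CovariantCurlOfGrad

end
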